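import Literature.IUT.HodgeTheaters.TemperedCoveringsProp24Sub
import Literature.IUT.HodgeTheaters.TemperedCoveringsCor23iiiProofs
import HarnessLib

/-!
# [IUTchI] Prop. 2.4 (i): the steps (L2), (L3) of the printed proof DERIVED from their printed inputs — PROOFS

Mochizuki, *Inter-universal Teichmüller theory I*, kurims manuscript (May 2020), §2, Proposition 2.4 (i),
proof p. 50 l. 25–42 ([IUTchI] Prop 2.4(i) p.50) [claim: Mochizuki2012, status: disputed] (D-0012 claim key;
nothing of the series is asserted).  PROOF-ONLY companion of `TemperedCoveringsProp24Sub.lean` (sub-DAG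
plan/L5/SUBDAG-IUTchI-Prop24.md, seat abc-iut-w5-d119):

* `Prop24Tower.translate_of_dense` — (L3) "we may assume without loss of generality that `γ` lies in the
  closure `Ĵ` of `J` in `Π̂_X`" (p. 50 l. 34–36) FROM the density of `Δ^tp_X` in `Δ̂_X` (p. 47) and the openness
  of `Ĵ ∩ Δ̂_X` in `Δ̂_X`: `Π̂_X = ι(Π^tp_X)·Ĵ`;
* `Prop24Tower.levelsDetect_of_stronglyTorsionFree` — (L2) "there exists a finite index characteristic open
  subgroup `J ⊆ Δ^tp_X` such that … `J ∩ Λ` has nontrivial image in the pro-`Σ` completion of the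
  abelianization of `J`, hence in `Π^tp_{𝔾_J}`" (p. 50 l. 27–33), at every level below that `J`, FROM "`Δ̂_X` is
  strongly torsion-free" ([Config] Rmk 1.2.2, typed `StronglyTorsionFreeSigma`) and the `p ∉ Σ` abelianization
  comparison (`SpecializationAb`), for `Π̂_X` profinite: pick `1 ≠ x₀ ∈ Λ`, an open normal `U ⊴ Δ̂_X` missing
  `ι(x₀)`, `H := U·⟨ι(x₀)⟩` (open; `H/U` cyclic of `Σ`-order since `Λ` is pro-`Σ`), so `ι(x₀)` is detected by
  the `Σ`-character `H → H/U`; by strong torsion-freeness so is `ι(x₀)^m`, `m = [H : Ĵ ∩ Δ̂_X]`, which lies in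
  every normal level `Ĵ ⊆ H`; restricting the character to `Ĵ ∩ Δ̂_X` and applying `SpecializationAb`
  contrapositively, `x₀^m ∈ J ∩ Λ` has nontrivial image in `Π^tp_{𝔾_J}`;
* `prop24i_of_sub`, `prop24iii_of_sub` — abc-iut-L5-t1's `Prop24i D` / `Prop24iii D` AS TYPED from the named
  sub-nodes only (tower inference `prop24i_of_tower`; (iii) via p407271 `prop24iii_of_prop24i'`).

Nothing here bears on [IUTchIII] Cor. 3.12; typed ≠ discharged (the sub-nodes are statements about the
genuine tower, L3/L4 merge objects).
-/

namespace Literature.IUT.HodgeTheaters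

open Pointwise
open _root_.Topology
open Literature.AnabelianGeometry.SemiGraphs (IsProSigma)
-- Mathlib's (deliberately scoped) instance `[Group G] [IsMulCommutative G] : CommGroup G`: the cyclic
-- subgroups `Subgroup.zpowers g` (`zpowers_isMulCommutative`) serve as finite ABELIAN character targets.
open scoped IsMulCommutative

universe u

namespace StableCurveTemperedData

variable {D : StableCurveTemperedData.{u}}

/-- `ι : Δ^tp_X → Δ̂_X` is continuous. [cite: Mochizuki2012, §2 p.47] -/
theorem continuous_ιΔ (D : StableCurveTemperedData.{u}) : Continuous D.ιΔ :=
  continuous_induced_rng.2 (D.ιX_continuous.comp continuous_subtype_val)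

-- `StableCurveTemperedData.ιΔ_injective` (`ι : Δ^tp_X → Δ̂_X` injective) is used BY NAME from
-- `TemperedCoveringsCor23iiiProofs.lean` (p411765); v2 (dedup, abc-iut-w4-d058) deletes the duplicate copy.

namespace Prop24Tower

variable (T : D.Prop24Tower)

/-- Open levels inside a closed `Δ̂_X` are closed in `Π̂_X`. [cite: Mochizuki2012, Prop 2.4(i) p.50] -/
theorem levelsClosed_of_open (hΔc : D.DeltaHatClosed) (hΔ : T.LevelsInDelta) (ho : T.LevelsOpen) :
    T.LevelsClosed := by
  intro i
  have hJ'c : IsClosed (((T.Jhat i).subgroupOf D.DeltaHat : Subgroup D.DeltaHat) : Set D.DeltaHat) :=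
    Subgroup.isClosed_of_isOpen _ (ho i)
  have himg : ((T.Jhat i : Subgroup D.PiHat) : Set D.PiHat) =
      Subtype.val '' (((T.Jhat i).subgroupOf D.DeltaHat : Subgroup D.DeltaHat) : Set D.DeltaHat) := by
    ext y
    constructor
    · intro hy
      exact ⟨⟨y, hΔ i hy⟩, hy, rfl⟩
    · rintro ⟨z, hz, rfl⟩
      exact hz
  rw [himg]
  exact hΔc.isClosedEmbedding_subtypeVal.isClosedMap _ hJ'c

/-- **(L3) from density** (p. 50 l. 34–36 ⇐ p. 47): `Π̂_X = ι(Π^tp_X)·Ĵ_i` at every level whose trace on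
`Δ̂_X` is open, given that `Δ^tp_X` is dense in `Δ̂_X` and `Π^tp_X ↠ G_k`. [cite: Mochizuki2012, Prop 2.4(i) p.50] -/
theorem translate_of_dense (hd : D.DeltaHatDense) (ho : T.LevelsOpen) : T.Translate := by
  intro i γ
  -- a tempered `t₀` with the same image in `G_k`; `δ := ι(t₀)⁻¹ γ ∈ Δ̂_X`
  obtain ⟨t₀, ht₀⟩ := D.prTp_surjective (D.prHat γ)
  set δ : D.PiHat := (D.ιX t₀)⁻¹ * γ with hδdef
  have hδ : δ ∈ D.DeltaHat := by
    rw [MonoidHom.mem_ker, hδdef, map_mul, map_inv, D.prHat_ιX, ht₀, inv_mul_cancel]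
  -- the open subset `δ·(Ĵ_i ∩ Δ̂_X)` of `Δ̂_X` meets the dense image of `Δ^tp_X`
  set O : Set D.DeltaHat :=
    (fun z : D.DeltaHat => (⟨δ, hδ⟩ : D.DeltaHat)⁻¹ * z) ⁻¹'
      (((T.Jhat i).subgroupOf D.DeltaHat : Subgroup D.DeltaHat) : Set D.DeltaHat) with hO
  have hOopen : IsOpen O := (ho i).preimage (continuous_const.mul continuous_id)
  have hδO : (⟨δ, hδ⟩ : D.DeltaHat) ∈ O := by
    show (⟨δ, hδ⟩ : D.DeltaHat)⁻¹ * ⟨δ, hδ⟩ ∈ (T.Jhat i).subgroupOf D.DeltaHat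
    rw [inv_mul_cancel]
    exact one_mem _
  obtain ⟨V, hV, hVO⟩ := isOpen_induced_iff.mp hOopen
  have hδV : δ ∈ V := by
    have : (⟨δ, hδ⟩ : D.DeltaHat) ∈ Subtype.val ⁻¹' V := by rw [hVO]; exact hδO
    exact this
  obtain ⟨y, hyV, ⟨d, rfl⟩⟩ := mem_closure_iff.mp (hd hδ) V hV hδV
  -- `ι(d) ∈ δ·Ĵ_i`, i.e. `ι(t₀ d)⁻¹ γ ∈ Ĵ_i`
  have hdΔ : D.ιX (d : D.PiTp) ∈ D.DeltaHat := by
    rw [MonoidHom.mem_ker, D.prHat_ιX]; exact d.2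
  have hdO : (⟨D.ιX (d : D.PiTp), hdΔ⟩ : D.DeltaHat) ∈ O := by
    have : (⟨D.ιX (d : D.PiTp), hdΔ⟩ : D.DeltaHat) ∈ Subtype.val ⁻¹' V := hyV
    rwa [hVO] at this
  have hmem : δ⁻¹ * D.ιX (d : D.PiTp) ∈ T.Jhat i := hdO
  refine ⟨t₀ * (d : D.PiTp), ?_⟩
  have hinv : (D.ιX (d : D.PiTp))⁻¹ * δ ∈ T.Jhat i := by
    have := (T.Jhat i).inv_mem hmem
    rwa [mul_inv_rev, inv_inv] at this
  have : (D.ιX (t₀ * (d : D.PiTp)))⁻¹ * γ = (D.ιX (d : D.PiTp))⁻¹ * δ := by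
    rw [hδdef, map_mul, mul_inv_rev, mul_assoc]
  rw [this]
  exact hinv

/-- **(L2) from strong torsion-freeness and the abelianization comparison** (p. 50 l. 27–33; `Π̂_X`
profinite, `Δ̂_X` closed; levels normal, open and cofinal in `Δ̂_X`): for every nontrivial pro-`Σ` compact
`Λ ⊆ Δ^tp_X` there is a level below which `J ∩ Λ` has nontrivial image in `Π^tp_{𝔾_J}` at every level `J`.
[cite: Mochizuki2012, Prop 2.4(i) p.50] -/
theorem levelsDetect_of_stronglyTorsionFree [T2Space D.PiHat] [TotallyDisconnectedSpace D.PiHat]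
    (hΔc : D.DeltaHatClosed) (hstf : D.StronglyTorsionFreeSigma) (hspec : T.SpecializationAb)
    (hn : T.LevelsNormal) (ho : T.LevelsOpen) (hcof : T.LevelsCofinal) (hΔ : T.LevelsInDelta) :
    T.LevelsDetect := by
  intro Λ hΛc hΛne hΛS
  haveI : CompactSpace D.DeltaHat := isCompact_iff_compactSpace.mp hΔc.isCompact
  -- an element `x₀ ≠ 1` of `Λ` and its image `g₀ ∈ Δ̂_X`
  obtain ⟨x₀, hx₀Λ, hx₀ne⟩ : ∃ x₀ ∈ Λ, x₀ ≠ 1 := by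
    by_contra h
    push Not at h
    exact hΛne ((Subgroup.eq_bot_iff_forall _).mpr h)
  set g₀ : D.DeltaHat := D.ιΔ x₀ with hg₀def
  have hg₀ne : g₀ ≠ 1 := fun h => hx₀ne (D.ιΔ_injective (by rw [← hg₀def, h, map_one]))
  -- an open normal subgroup `U ⊴ Δ̂_X` missing `g₀`
  obtain ⟨U, hU⟩ := ProfiniteGrp.exist_openNormalSubgroup_sub_open_nhds_of_one
    (isOpen_compl_singleton (x := g₀)) (by simpa using hg₀ne.symm)
  have hg₀U : g₀ ∉ U := fun h => hU h rfl
  -- `H := U·⟨g₀⟩`, the preimage of the cyclic group generated by `g₀` modulo `U`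
  set π : D.DeltaHat →* D.DeltaHat ⧸ U.toSubgroup := QuotientGroup.mk' U.toSubgroup with hπ
  set C : Subgroup (D.DeltaHat ⧸ U.toSubgroup) := Subgroup.zpowers (π g₀) with hC
  set H : Subgroup D.DeltaHat := C.comap π with hH
  have hUH : U.toSubgroup ≤ H := by
    intro u hu
    rw [hH, Subgroup.mem_comap, hπ, QuotientGroup.mk'_apply, (QuotientGroup.eq_one_iff u).mpr hu]
    exact one_mem _
  have hHopen : IsOpen (H : Set D.DeltaHat) := Subgroup.isOpen_mono hUH U.isOpen'
  have hg₀H : g₀ ∈ H := by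
    rw [hH, Subgroup.mem_comap]
    exact Subgroup.mem_zpowers _
  -- the `Σ`-character `χ : H → C`, `h ↦ h mod U`
  haveI : Finite (D.DeltaHat ⧸ U.toSubgroup) := Subgroup.quotient_finite_of_isOpen _ U.isOpen'
  let χ : H →* C := (π.comp H.subtype).codRestrict C fun h => h.2
  have hχker : IsOpen ((χ.ker : Subgroup H) : Set H) := by
    have e : ((χ.ker : Subgroup H) : Set H) = Subtype.val ⁻¹' (U : Set D.DeltaHat) := by
      ext h
      simp only [SetLike.mem_coe, MonoidHom.mem_ker, Set.mem_preimage]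
      constructor
      · intro h1
        have h2 : π (h : D.DeltaHat) = 1 := by
          have := congrArg Subtype.val h1
          simpa [χ] using this
        exact (QuotientGroup.eq_one_iff _).mp h2
      · intro h1
        apply Subtype.ext
        show π (h : D.DeltaHat) = 1
        exact (QuotientGroup.eq_one_iff _).mpr h1
    rw [e]
    exact U.isOpen'.preimage continuous_subtype_val
  have hχg₀ : χ ⟨g₀, hg₀H⟩ ≠ 1 := by
    intro h1
    have h2 : π g₀ = 1 := by
      have := congrArg Subtype.val h1
      simpa [χ] using this
    exact hg₀U ((QuotientGroup.eq_one_iff _).mp h2)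
  -- `C` has `Σ`-order: it lies in the image of the pro-`Σ` group `Λ` in the finite group `Δ̂_X/U`
  have hCS : ∀ p : ℕ, p.Prime → p ∣ Nat.card C → p ∈ D.graph.Sigma := by
    set φ : Λ →* D.DeltaHat ⧸ U.toSubgroup := π.comp (D.ιΔ.comp Λ.subtype) with hφ
    have hkerφ : ((φ.ker : Subgroup Λ) : Set Λ) =
        (fun l : Λ => D.ιΔ (l : D.DeltaTp)) ⁻¹' (U : Set D.DeltaHat) := by
      ext l
      simp only [SetLike.mem_coe, MonoidHom.mem_ker, Set.mem_preimage, hφ, hπ, MonoidHom.comp_apply,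
        Subgroup.coe_subtype, QuotientGroup.mk'_apply, QuotientGroup.eq_one_iff]
      rfl
    let N : OpenNormalSubgroup Λ :=
      { toSubgroup := φ.ker
        isOpen' := by
          change IsOpen ((φ.ker : Subgroup Λ) : Set Λ)
          rw [hkerφ]
          exact U.isOpen'.preimage (D.continuous_ιΔ.comp continuous_subtype_val)
        isNormal' := inferInstance }
    haveI hfinr : Finite φ.range := inferInstance
    have eqv : Λ ⧸ N.toSubgroup ≃ φ.range := (QuotientGroup.quotientKerEquivRange φ).toEquiv
    haveI : Finite (Λ ⧸ N.toSubgroup) := Finite.of_equiv _ eqv.symm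
    have hCle : C ≤ φ.range := by
      rw [hC, Subgroup.zpowers_le]
      exact ⟨⟨x₀, hx₀Λ⟩, by rw [hφ, hg₀def]; rfl⟩
    intro p hp hdvd
    refine hΛS.prime_mem N inferInstance p hp (hdvd.trans ?_)
    rw [Nat.card_congr eqv]
    exact Subgroup.card_dvd_of_le hCle
  have hdet₀ : SigmaCharDetects D.graph.Sigma H ⟨g₀, hg₀H⟩ := ⟨C, inferInstance, inferInstance, χ, hχker, hCS, hχg₀⟩
  -- a level `Ĵ_{i₀} ⊆ H`
  obtain ⟨i₀, hi₀⟩ := hcof H hHopen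
  refine ⟨H.map D.DeltaHat.subtype, ⟨i₀, fun y hy => ?_⟩, fun i hi => ?_⟩
  · exact ⟨⟨y, hΔ i₀ hy⟩, hi₀ (show (⟨y, hΔ i₀ hy⟩ : D.DeltaHat) ∈ (T.Jhat i₀).subgroupOf D.DeltaHat from hy),
      rfl⟩
  -- at a level `Ĵ_i ⊆ H`: `J'_i := Ĵ_i ∩ Δ̂_X ⊆ H`, normal, of finite index `m`
  set J' : Subgroup D.DeltaHat := (T.Jhat i).subgroupOf D.DeltaHat with hJ'
  have hJH : J' ≤ H := by
    intro z hz
    obtain ⟨h, hh, hhz⟩ := hi (show (z : D.PiHat) ∈ T.Jhat i from hz)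
    have : z = h := Subtype.ext hhz.symm
    rw [this]; exact hh
  set N : Subgroup H := J'.subgroupOf H with hN
  haveI hNn : N.Normal := by rw [hN, hJ']; exact (hn i).subgroupOf H
  have hNopen : IsOpen (N : Set H) := by
    have e : (N : Set H) = Subtype.val ⁻¹' (J' : Set D.DeltaHat) := rfl
    rw [e]; exact (ho i).preimage continuous_subtype_val
  haveI : CompactSpace H := isCompact_iff_compactSpace.mp (Subgroup.isClosed_of_isOpen _ hHopen).isCompact
  haveI : Finite (H ⧸ N) := Subgroup.quotient_finite_of_isOpen _ hNopen
  haveI hNfi : N.FiniteIndex := Subgroup.finiteIndex_of_finite_quotient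
  set m : ℕ := N.index with hm
  have hm0 : m ≠ 0 := hNfi.index_ne_zero
  -- strong torsion-freeness: `g₀ ^ m` is still detected in `H`, and lies in `J'_i`
  obtain ⟨A, _, _, χ', hχ'ker, hχ'S, hχ'ne⟩ := hstf H hHopen ⟨g₀, hg₀H⟩ m hm0 hdet₀
  have hgmN : (⟨g₀, hg₀H⟩ : H) ^ m ∈ N := by rw [hm]; exact Subgroup.pow_index_mem N _
  have hgmJ' : g₀ ^ m ∈ J' := hgmN
  -- the element `x := x₀ ^ m ∈ Λ ∩ J_i`
  have hxJ : D.ιX ((x₀ ^ m : D.DeltaTp) : D.PiTp) ∈ T.Jhat i := by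
    have e : D.ιX ((x₀ ^ m : D.DeltaTp) : D.PiTp) = ((g₀ ^ m : D.DeltaHat) : D.PiHat) := by
      rw [hg₀def, ← map_pow, coe_ιΔ]
    rw [e]; exact hgmJ'
  refine ⟨x₀ ^ m, Λ.pow_mem hx₀Λ m, hxJ, fun h1 => ?_⟩
  -- if `π_i(x) = 1`, `SpecializationAb` kills every `Σ`-character of `J'_i` on `ι(x)`; but `χ'|_{J'_i}` detects it
  apply hspec i (x₀ ^ m) hxJ h1
  have hinc : Continuous (Subgroup.inclusion hJH) :=
    continuous_induced_rng.2 continuous_subtype_val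
  refine ⟨A, inferInstance, inferInstance, χ'.comp (Subgroup.inclusion hJH), ?_, hχ'S, ?_⟩
  · have e : (((χ'.comp (Subgroup.inclusion hJH)).ker : Subgroup J') : Set J') =
        Subgroup.inclusion hJH ⁻¹' ((χ'.ker : Subgroup H) : Set H) := by
      ext z; simp [MonoidHom.mem_ker]
    rw [e]; exact hχ'ker.preimage hinc
  · have e : Subgroup.inclusion hJH ⟨D.ιΔ (x₀ ^ m), hxJ⟩ = (⟨g₀, hg₀H⟩ : H) ^ m := by
      apply Subtype.ext
      simp only [Subgroup.coe_inclusion, SubmonoidClass.coe_pow, hg₀def, map_pow]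
    rw [MonoidHom.comp_apply, e]
    exact hχ'ne

end Prop24Tower

/-- **[IUTchI] Prop. 2.4 (i) from the NAMED sub-nodes** of plan/L5/SUBDAG-IUTchI-Prop24.md (for `Π̂_X`
profinite): `Δ̂_X` closed, `Δ^tp_X` dense in it, `Δ̂_X` strongly torsion-free ([Config] Rmk 1.2.2); a tower of
normal open cofinal levels inside `Δ̂_X` with (L1) Prop. 2.1 at every level, (L2b) the `p ∉ Σ` abelianization
comparison, and (INV) the inverse-limit detection of temperedness.  Conclusion: abc-iut-L5-t1's `Prop24i D`
AS TYPED. [cite: Mochizuki2012, Prop 2.4(i) p.50] -/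
theorem prop24i_of_sub [T2Space D.PiHat] [TotallyDisconnectedSpace D.PiHat] (T : D.Prop24Tower)
    (hΔc : D.DeltaHatClosed) (hd : D.DeltaHatDense) (hstf : D.StronglyTorsionFreeSigma)
    (hΔ : T.LevelsInDelta) (hn : T.LevelsNormal) (ho : T.LevelsOpen) (hcof : T.LevelsCofinal)
    (h21 : T.Prop21Levels) (hspec : T.SpecializationAb) (hINV : T.DetectsTempered) : D.Prop24i :=
  T.prop24i_of_tower (T.levelsClosed_of_open hΔc hΔ ho) h21
    (T.levelsDetect_of_stronglyTorsionFree hΔc hstf hspec hn ho hcof hΔ) (T.translate_of_dense hd ho) hINV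

/-- **[IUTchI] Prop. 2.4 (iii) from the NAMED sub-nodes** (as `prop24i_of_sub`, plus the pro-`Σ` Sylow input
`HasCompactProSigma` and `Π^tp_X` Hausdorff; (iii) ⇐ (i) is p407271's `prop24iii_of_prop24i'`).
[cite: Mochizuki2012, Prop 2.4(iii) p.51] -/
theorem prop24iii_of_sub [T2Space D.PiHat] [TotallyDisconnectedSpace D.PiHat] [T2Space D.PiTp]
    (T : D.Prop24Tower) (hΔc : D.DeltaHatClosed) (hd : D.DeltaHatDense) (hstf : D.StronglyTorsionFreeSigma)
    (hΔ : T.LevelsInDelta) (hn : T.LevelsNormal) (ho : T.LevelsOpen) (hcof : T.LevelsCofinal)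
    (h21 : T.Prop21Levels) (hspec : T.SpecializationAb) (hINV : T.DetectsTempered)
    (hV : D.HasCompactProSigma) : D.Prop24iii :=
  D.prop24iii_of_prop24i' (prop24i_of_sub T hΔc hd hstf hΔ hn ho hcof h21 hspec hINV) hV

end StableCurveTemperedData

end Literature.IUT.HodgeTheaters
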